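import Summits.QuantumFields.GaugeBoot.LoopEquationSpectatorPair
import HarnessLib

/-!
# The single-link loop equation with one SPECTATOR loop (two-word / double-trace form) (gauge-boot, Lean layer, ADDENDUM 22 part B, file 2/2)

HONEST FRAMING (cell `pub-gaugeboot`, page 1 of every file): the venture produces certified bounds
on lattice expectations at stated coupling, gauge group, dimension and torus size; NOT a mass gap,
NOT a continuum limit, NOT a string tension; NOT Yang–Mills-summit-bearing (barriers
`FixedCouplingUltralocality`, `PerturbativeInvisibility`).  This file enters no number: it is the
exact Schwinger–Dyson identity behind the double-trace rows of the finite-`N` bootstrap.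

## Content

Assembly of the two-word pair identity of `LoopEquationSpectatorPair.lean` over the matrix units `E_ij − (s/N)δ_ij`
(`loopEquation₂_of_sdPair₂`; `SU(N)`: `loopEquation₂_specialUnitaryGroup`, `s = 1`; `U(N)`:
`loopEquation₂_unitaryGroup`, `s = 0`): for `w` closed at `x`, any spectator word `v` from `x₁`, every real `β`,
every `d` and every torus side `L`,

`Σ_k E[splitTerm_k(w)·tr ρ(hol v)] + Σ_{k'} E[mergeTerm_{k'}(w, v)] + (β/2)·Σ_{ν≠μ,ε} E[plaqTerm_{ν,ε}(w)·tr ρ(hol v)] = 0`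

— Kazakov–Zheng's finite-`N` two-loop Makeenko–Migdal equation as an unconditional theorem about the finite torus.
With a spectator that AVOIDS the edge all merge terms vanish and the identity is the single-loop equation with a
bounded spectator weight (the tool bounding the double traces `E[tr U_P · tr U_Q]` at strong coupling,
`StrongCouplingPlaquetteSUN`); with `v = w =` a plaquette it ties `E[(tr U_P)²]` to `E[tr U_P²]`
(`StrongCouplingPlaquetteUN`).

References: V. Kazakov, Z. Zheng, arXiv:2404.16925 §2.3; P. Anderson, M. Kruczenski, Nucl. Phys. B 921 (2017);
S. Chatterjee, arXiv:1502.07719 §3.  Everything is `[folklore]` given the tree's Schwinger–Dyson identity.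
-/

noncomputable section

open MeasureTheory Filter Topology NormedSpace
open scoped Matrix.Norms.Frobenius Matrix
open Literature.MathematicalPhysics.QuantumFieldTheory
open Summit.QuantumFields.YangMills.Cruxes.CurvatureAmnesia.WardDefect.SchwingerDyson

namespace Summit.QuantumFields.GaugeBoot

variable {d L N : ℕ} {G : Type} [Group G] {ρ : G →* Matrix (Fin N) (Fin N) ℂ}


/-! ## The two-word loop equation -/

section Assembly

variable [TopologicalSpace G] [IsTopologicalGroup G] [CompactSpace G] [MeasurableSpace G] [BorelSpace G]
  (r : LatticeRep G)

/-- **THE SINGLE-LINK LOOP EQUATION WITH ONE SPECTATOR (abstract form).**  Let `G` be compact with lattice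
representation `r`, `β` real, `e = (x, μ)` an edge of `(ℤ/L)^d`, `w` a word CLOSED at `x`, `v` any word read from `x₁`,
and `s ∈ ℂ` a weight such that every direction `X_ij = E_ij − (s/N)δ_ij·1` satisfies the two-word pair identity
(`s = 1`: `G = SU(N)`; `s = 0`: `G = U(N)`).  Then
`Σ_k E[splitTerm_k(w)·tr ρ(hol v)] + Σ_{k'} E[mergeTerm_{k'}(w, v)] + (β/2)·Σ_{ν≠μ} Σ_ε E[plaqTerm_{ν,ε}(w)·tr ρ(hol v)] = 0`
— Kazakov–Zheng's two-loop Makeenko–Migdal equation (arXiv:2404.16925 §2.3) as a theorem about the finite torus.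
[folklore] -/
theorem loopEquation₂_of_sdPair₂ [NeZero L] (β : ℝ) (x : Site d L) (μ : Fin d) (s : ℂ) (w : Word d)
    (hw : Word.endpoint x w = x) (x₁ : Site d L) (v : Word d)
    (hP : ∀ i j : Fin r.N, SDPair₂ r β x μ x w x₁ v (unitDir s i j)) :
    (∑ k ∈ Finset.range w.length, ∫ U, splitTerm r.ρ s x μ U w k * (r.ρ (wordHolonomy U x₁ v)).trace
        ∂(wilsonMeasure (d := d) (L := L) r.ρ β)) +
      (∑ k ∈ Finset.range v.length, ∫ U, mergeTerm r.ρ s x μ U w x₁ v k ∂(wilsonMeasure (d := d) (L := L) r.ρ β)) +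
      (β / 2 : ℂ) * ∑ ν ∈ Finset.univ.erase μ, ∑ ε : Bool,
        ∫ U, plaqTerm r.ρ s x μ U w ν ε * (r.ρ (wordHolonomy U x₁ v)).trace
          ∂(wilsonMeasure (d := d) (L := L) r.ρ β) = 0 := by
  set μW := wilsonMeasure (d := d) (L := L) r.ρ β with hμW
  have hf : ∀ i j : Fin r.N, Integrable (fun U => (Matrix.single j i (1 : ℂ) * insDeriv r.ρ (x, μ) (unitDir s i j)
      U x w).trace * (r.ρ (wordHolonomy U x₁ v)).trace + (Matrix.single j i (1 : ℂ) * r.ρ (wordHolonomy U x w)).trace *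
        (insDeriv r.ρ (x, μ) (unitDir s i j) U x₁ v).trace) μW :=
    fun i j => integrable_of_continuous r β (continuous_lhs₂ r _ _ x μ x w x₁ v)
  have hg : ∀ i j : Fin r.N, Integrable (fun U => (Matrix.single j i (1 : ℂ) * r.ρ (wordHolonomy U x w)).trace *
      (r.ρ (wordHolonomy U x₁ v)).trace * (-(1 / 2) * plaqIns r.ρ (unitDir s i j) U x μ)) μW :=
    fun i j => integrable_of_continuous r β (continuous_rhs₂ r _ _ x μ x w x₁ v)
  -- pointwise: the contracted left side is `Σ_k splitTerm_k · tr hol v + Σ_k' mergeTerm_k'`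
  have hL : ∀ U : GaugeConfig d L G, ∑ i : Fin r.N, ∑ j : Fin r.N,
      ((Matrix.single j i (1 : ℂ) * insDeriv r.ρ (x, μ) (unitDir s i j) U x w).trace *
          (r.ρ (wordHolonomy U x₁ v)).trace +
        (Matrix.single j i (1 : ℂ) * r.ρ (wordHolonomy U x w)).trace *
          (insDeriv r.ρ (x, μ) (unitDir s i j) U x₁ v).trace) =
      (∑ k ∈ Finset.range w.length, splitTerm r.ρ s x μ U w k) * (r.ρ (wordHolonomy U x₁ v)).trace +
        ∑ k ∈ Finset.range v.length, mergeTerm r.ρ s x μ U w x₁ v k := by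
    intro U
    simp only [Finset.sum_add_distrib]
    rw [← sum_trace_insDeriv_unitDir s x μ U w, ← sum_trace_mul_trace_insDeriv_unitDir s x μ U w x₁ v,
      Finset.sum_mul]
    congr 1
    exact Finset.sum_congr rfl fun i _ => by rw [Finset.sum_mul]
  -- pointwise: the contracted right side
  have hR : ∀ U : GaugeConfig d L G, ∑ i : Fin r.N, ∑ j : Fin r.N,
      (Matrix.single j i (1 : ℂ) * r.ρ (wordHolonomy U x w)).trace * (r.ρ (wordHolonomy U x₁ v)).trace *
        (-(1 / 2) * plaqIns r.ρ (unitDir s i j) U x μ) =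
      (-(1 / 2) * ∑ ν ∈ Finset.univ.erase μ, ∑ ε : Bool, plaqTerm r.ρ s x μ U w ν ε) *
        (r.ρ (wordHolonomy U x₁ v)).trace := by
    intro U
    rw [← sum_trace_mul_plaqIns_unitDir s x μ U w hw, Finset.sum_mul]
    refine Finset.sum_congr rfl fun i _ => ?_
    rw [Finset.sum_mul]
    exact Finset.sum_congr rfl fun j _ => by ring
  -- integrate the contracted identity
  have hsum : ∫ U, ((∑ k ∈ Finset.range w.length, splitTerm r.ρ s x μ U w k) * (r.ρ (wordHolonomy U x₁ v)).trace +
      ∑ k ∈ Finset.range v.length, mergeTerm r.ρ s x μ U w x₁ v k) ∂μW =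
      (β : ℂ) * ∫ U, (-(1 / 2) * ∑ ν ∈ Finset.univ.erase μ, ∑ ε : Bool, plaqTerm r.ρ s x μ U w ν ε) *
        (r.ρ (wordHolonomy U x₁ v)).trace ∂μW := by
    calc ∫ U, ((∑ k ∈ Finset.range w.length, splitTerm r.ρ s x μ U w k) * (r.ρ (wordHolonomy U x₁ v)).trace +
          ∑ k ∈ Finset.range v.length, mergeTerm r.ρ s x μ U w x₁ v k) ∂μW
        = ∫ U, ∑ i : Fin r.N, ∑ j : Fin r.N,
            ((Matrix.single j i (1 : ℂ) * insDeriv r.ρ (x, μ) (unitDir s i j) U x w).trace *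
                (r.ρ (wordHolonomy U x₁ v)).trace +
              (Matrix.single j i (1 : ℂ) * r.ρ (wordHolonomy U x w)).trace *
                (insDeriv r.ρ (x, μ) (unitDir s i j) U x₁ v).trace) ∂μW :=
          integral_congr_ae (ae_of_all _ fun U => (hL U).symm)
      _ = ∑ i : Fin r.N, ∑ j : Fin r.N, ∫ U,
            ((Matrix.single j i (1 : ℂ) * insDeriv r.ρ (x, μ) (unitDir s i j) U x w).trace *
                (r.ρ (wordHolonomy U x₁ v)).trace +
              (Matrix.single j i (1 : ℂ) * r.ρ (wordHolonomy U x w)).trace *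
                (insDeriv r.ρ (x, μ) (unitDir s i j) U x₁ v).trace) ∂μW := by
          rw [integral_finsetSum _ fun i _ => integrable_finsetSum _ fun j _ => hf i j]
          exact Finset.sum_congr rfl fun i _ => integral_finsetSum _ fun j _ => hf i j
      _ = ∑ i : Fin r.N, ∑ j : Fin r.N, (β : ℂ) * ∫ U, (Matrix.single j i (1 : ℂ) * r.ρ (wordHolonomy U x w)).trace *
            (r.ρ (wordHolonomy U x₁ v)).trace * (-(1 / 2) * plaqIns r.ρ (unitDir s i j) U x μ) ∂μW :=
          Finset.sum_congr rfl fun i _ => Finset.sum_congr rfl fun j _ => hP i j (Matrix.single j i 1)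
      _ = (β : ℂ) * ∑ i : Fin r.N, ∑ j : Fin r.N, ∫ U, (Matrix.single j i (1 : ℂ) * r.ρ (wordHolonomy U x w)).trace *
            (r.ρ (wordHolonomy U x₁ v)).trace * (-(1 / 2) * plaqIns r.ρ (unitDir s i j) U x μ) ∂μW := by
          simp only [Finset.mul_sum]
      _ = (β : ℂ) * ∫ U, ∑ i : Fin r.N, ∑ j : Fin r.N, (Matrix.single j i (1 : ℂ) * r.ρ (wordHolonomy U x w)).trace *
            (r.ρ (wordHolonomy U x₁ v)).trace * (-(1 / 2) * plaqIns r.ρ (unitDir s i j) U x μ) ∂μW := by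
          rw [integral_finsetSum _ fun i _ => integrable_finsetSum _ fun j _ => hg i j]
          congr 1
          exact (Finset.sum_congr rfl fun i _ => integral_finsetSum _ fun j _ => hg i j).symm
      _ = (β : ℂ) * ∫ U, (-(1 / 2) * ∑ ν ∈ Finset.univ.erase μ, ∑ ε : Bool, plaqTerm r.ρ s x μ U w ν ε) *
            (r.ρ (wordHolonomy U x₁ v)).trace ∂μW := by
          congr 1
          exact integral_congr_ae (ae_of_all _ fun U => hR U)
  -- split the integrals into the stated sums
  have hi1 : ∀ k, Integrable (fun U => splitTerm r.ρ s x μ U w k * (r.ρ (wordHolonomy U x₁ v)).trace) μW :=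
    fun k => integrable_of_continuous r β ((continuous_splitTerm r s x μ w k).mul (continuous_trace_wordHolonomy r x₁ v))
  have hi2 : ∀ k, Integrable (fun U => mergeTerm r.ρ s x μ U w x₁ v k) μW :=
    fun k => integrable_of_continuous r β (continuous_mergeTerm r s x μ w x₁ v k)
  have hi3 : ∀ ν ε, Integrable (fun U => plaqTerm r.ρ s x μ U w ν ε * (r.ρ (wordHolonomy U x₁ v)).trace) μW :=
    fun ν ε => integrable_of_continuous r β ((continuous_plaqTerm r s x μ w ν ε).mul
      (continuous_trace_wordHolonomy r x₁ v))
  have h1 : ∫ U, ((∑ k ∈ Finset.range w.length, splitTerm r.ρ s x μ U w k) * (r.ρ (wordHolonomy U x₁ v)).trace +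
      ∑ k ∈ Finset.range v.length, mergeTerm r.ρ s x μ U w x₁ v k) ∂μW =
      (∑ k ∈ Finset.range w.length, ∫ U, splitTerm r.ρ s x μ U w k * (r.ρ (wordHolonomy U x₁ v)).trace ∂μW) +
        ∑ k ∈ Finset.range v.length, ∫ U, mergeTerm r.ρ s x μ U w x₁ v k ∂μW := by
    simp_rw [Finset.sum_mul]
    rw [integral_add (integrable_finsetSum _ fun k _ => hi1 k) (integrable_finsetSum _ fun k _ => hi2 k),
      integral_finsetSum _ fun k _ => hi1 k, integral_finsetSum _ fun k _ => hi2 k]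
  have h2 : ∫ U, (-(1 / 2) * ∑ ν ∈ Finset.univ.erase μ, ∑ ε : Bool, plaqTerm r.ρ s x μ U w ν ε) *
      (r.ρ (wordHolonomy U x₁ v)).trace ∂μW =
      -(1 / 2) * ∑ ν ∈ Finset.univ.erase μ, ∑ ε : Bool,
        ∫ U, plaqTerm r.ρ s x μ U w ν ε * (r.ρ (wordHolonomy U x₁ v)).trace ∂μW := by
    have : ∀ U : GaugeConfig d L G, (-(1 / 2) * ∑ ν ∈ Finset.univ.erase μ, ∑ ε : Bool, plaqTerm r.ρ s x μ U w ν ε) *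
        (r.ρ (wordHolonomy U x₁ v)).trace = -(1 / 2) * ∑ ν ∈ Finset.univ.erase μ, ∑ ε : Bool,
          plaqTerm r.ρ s x μ U w ν ε * (r.ρ (wordHolonomy U x₁ v)).trace := fun U => by
      rw [mul_assoc, Finset.sum_mul]
      congr 1
      exact Finset.sum_congr rfl fun ν _ => Finset.sum_mul _ _ _
    simp_rw [this]
    rw [integral_const_mul]
    congr 1
    rw [integral_finsetSum _ fun ν _ => integrable_finsetSum _ fun ε _ => hi3 ν ε]
    exact Finset.sum_congr rfl fun ν _ => integral_finsetSum _ fun ε _ => hi3 ν ε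
  rw [h1, h2] at hsum
  linear_combination hsum

end Assembly

/-! ## `SU(N)` and `U(N)` -/

section Concrete

open Literature.MathematicalPhysics.QuantumLattice

/-- **`SU(N)`: every traceless direction satisfies the two-word pair identity.** [folklore] -/
theorem sdPair₂_specialUnitaryGroup [NeZero L] (N : ℕ) (β : ℝ) (x : Site d L) (μ : Fin d) (x₀ : Site d L)
    (w : Word d) (x₁ : Site d L) (v : Word d) (X : Matrix (Fin N) (Fin N) ℂ) (hX : X.trace = 0) :
    SDPair₂ (fundamentalLatticeRep N) β x μ x₀ w x₁ v X := by
  refine sdPair₂_of_traceless (fundamentalLatticeRep N) β x μ x₀ w x₁ v (fun X hXs hX0 => ?_) X hX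
  have hmem := mem_oneParamGenerators_specialUnitaryGroup (n := Fin N) (X := X) hXs hX0
  refine sdPair₂_of_oneParam (fundamentalLatticeRep N) β x μ x₀ w x₁ v hXs
    (k := fun t => ⟨NormedSpace.exp (t • X), hmem t⟩) (fun a b => Subtype.ext ?_) (fun t => ?_)
  · change NormedSpace.exp ((a + b) • X) = NormedSpace.exp (a • X) * NormedSpace.exp (b • X)
    rw [add_smul]
    exact Matrix.exp_add_of_commute _ _ (((Commute.refl X).smul_left a).smul_right b)
  · change NormedSpace.exp (t • X) = NormedSpace.exp ((t : ℂ) • X)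
    rw [Complex.coe_smul]

/-- **`U(N)`: every direction satisfies the two-word pair identity.** [folklore] -/
theorem sdPair₂_unitaryGroup [NeZero L] (N : ℕ) (β : ℝ) (x : Site d L) (μ : Fin d) (x₀ : Site d L) (w : Word d)
    (x₁ : Site d L) (v : Word d) (X : Matrix (Fin N) (Fin N) ℂ) :
    SDPair₂ (unitaryFundamentalLatticeRep N) β x μ x₀ w x₁ v X := by
  refine sdPair₂_of_skew (unitaryFundamentalLatticeRep N) β x μ x₀ w x₁ v (fun X hXs => ?_) X
  have hmem := mem_oneParamGenerators_unitaryGroup (n := Fin N) (X := X) hXs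
  refine sdPair₂_of_oneParam (unitaryFundamentalLatticeRep N) β x μ x₀ w x₁ v hXs
    (k := fun t => ⟨NormedSpace.exp (t • X), hmem t⟩) (fun a b => Subtype.ext ?_) (fun t => ?_)
  · change NormedSpace.exp ((a + b) • X) = NormedSpace.exp (a • X) * NormedSpace.exp (b • X)
    rw [add_smul]
    exact Matrix.exp_add_of_commute _ _ (((Commute.refl X).smul_left a).smul_right b)
  · change NormedSpace.exp (t • X) = NormedSpace.exp ((t : ℂ) • X)
    rw [Complex.coe_smul]

/-- **THE TWO-WORD LOOP EQUATION FOR LATTICE `SU(N)` YANG–MILLS** (Wilson action, torus `(ℤ/L)^d`, any `d, L ≥ 1`,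
any real `β`; `s = 1`): for every edge `e = (x, μ)`, every word `w` closed at `x` and every spectator word `v` from `x₁`,
`Σ_k E[splitTerm_k(w)·tr hol v] + Σ_{k'} E[mergeTerm_{k'}(w, v)] + (β/2)·Σ_{ν≠μ,ε} E[plaqTerm_{ν,ε}(w)·tr hol v] = 0`.
[folklore] -/
theorem loopEquation₂_specialUnitaryGroup [NeZero L] (N : ℕ) (β : ℝ) (x : Site d L) (μ : Fin d) (w : Word d)
    (hw : Word.endpoint x w = x) (x₁ : Site d L) (v : Word d) :
    (∑ k ∈ Finset.range w.length, ∫ U, splitTerm (fundamentalRep (Fin N)) 1 x μ U w k *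
        (fundamentalRep (Fin N) (wordHolonomy U x₁ v)).trace
          ∂(wilsonMeasure (d := d) (L := L) (fundamentalRep (Fin N)) β)) +
      (∑ k ∈ Finset.range v.length, ∫ U, mergeTerm (fundamentalRep (Fin N)) 1 x μ U w x₁ v k
          ∂(wilsonMeasure (d := d) (L := L) (fundamentalRep (Fin N)) β)) +
      (β / 2 : ℂ) * ∑ ν ∈ Finset.univ.erase μ, ∑ ε : Bool,
        ∫ U, plaqTerm (fundamentalRep (Fin N)) 1 x μ U w ν ε * (fundamentalRep (Fin N) (wordHolonomy U x₁ v)).trace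
          ∂(wilsonMeasure (d := d) (L := L) (fundamentalRep (Fin N)) β) = 0 :=
  loopEquation₂_of_sdPair₂ (fundamentalLatticeRep N) β x μ 1 w hw x₁ v
    fun i j => sdPair₂_specialUnitaryGroup N β x μ x w x₁ v _ (trace_unitDir_one i j)

/-- **THE TWO-WORD LOOP EQUATION FOR LATTICE `U(N)`** (`s = 0`: no `1/N` terms). [folklore] -/
theorem loopEquation₂_unitaryGroup [NeZero L] (N : ℕ) (β : ℝ) (x : Site d L) (μ : Fin d) (w : Word d)
    (hw : Word.endpoint x w = x) (x₁ : Site d L) (v : Word d) :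
    (∑ k ∈ Finset.range w.length, ∫ U, splitTerm (unitaryFundamentalRep (Fin N) ℂ) 0 x μ U w k *
        (unitaryFundamentalRep (Fin N) ℂ (wordHolonomy U x₁ v)).trace
          ∂(wilsonMeasure (d := d) (L := L) (unitaryFundamentalRep (Fin N) ℂ) β)) +
      (∑ k ∈ Finset.range v.length, ∫ U, mergeTerm (unitaryFundamentalRep (Fin N) ℂ) 0 x μ U w x₁ v k
          ∂(wilsonMeasure (d := d) (L := L) (unitaryFundamentalRep (Fin N) ℂ) β)) +
      (β / 2 : ℂ) * ∑ ν ∈ Finset.univ.erase μ, ∑ ε : Bool,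
        ∫ U, plaqTerm (unitaryFundamentalRep (Fin N) ℂ) 0 x μ U w ν ε *
          (unitaryFundamentalRep (Fin N) ℂ (wordHolonomy U x₁ v)).trace
          ∂(wilsonMeasure (d := d) (L := L) (unitaryFundamentalRep (Fin N) ℂ) β) = 0 :=
  loopEquation₂_of_sdPair₂ (unitaryFundamentalLatticeRep N) β x μ 0 w hw x₁ v
    fun _ _ => sdPair₂_unitaryGroup N β x μ x w x₁ v _

end Concrete

end Summit.QuantumFields.GaugeBoot

end
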